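import Literature.NumberTheory.Automorphic.HidaLatticeLevelTransfer
import HarnessLib

/-!
# Finite-level control in the `b`-direction on `H^i(U(b,c), ⨂_τ Sym^{k−2}(𝒪²))`

Topic `NumberTheory/Automorphic`; namespace `Literature.NumberTheory.Automorphic.ParallelWeight`;
theorems only, continuing `HidaLatticeLevelTransfer`.  For the Hida levels `U(b,c) ⊴ U(b',c)`
(`b' ≤ b ≤ c`, `max b' c ≥ 1`, tame level maximal above `p`) of the `p`-adic lattice cohomology,
the restriction `res : H(b') → H(b)^{T(b')}` has kernel and cokernel killed by the index
`[U(b',c) : U(b,c)]` — the mechanism of "`res` has finite kernel and cokernel onto the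
`T(b')/T(b)`-invariants" in [Hida1994AIF, §2 (proof of Thm 2.2)] ([KhareThorne2017, §6.3];
Brown, *Cohomology of Groups*, III Prop. 9.5, 10.1, 10.4):

* **`relIndex_smul_eq_zero_of_latticeRes_eq_zero`** — `res x = 0 ⇒ [U(b',c):U(b,c)] · x = 0`;
* **`relIndex_smul_mem_range_latticeRes`** — for a `T(b')`-invariant class `y ∈ H(b)`,
  `[U(b',c):U(b,c)] · y ∈ range res`.

## References

* H. Hida, Ann. Inst. Fourier 44 (1994), §2 (held). [Hida1994AIF]
* C. Khare, J. A. Thorne, Amer. J. Math. 139 (2017), §6.3 (arXiv:1409.7007, held). [KhareThorne2017]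
-/

noncomputable section

open CategoryTheory IsDedekindDomain NumberField

namespace Literature.NumberTheory.Automorphic.ParallelWeight

open BigHeckeGLn IntegralWeightGL2 LevelAction

variable (F : Type) [Field F] [NumberField F] (k : ℕ) (p : ℕ) [Fact p.Prime] {𝒰 : TameLevel 2 F p}

/-- **`ker res` is killed by the index**: `res x = 0 ⇒ [U(b',c) : U(b,c)] · x = 0` on
`H^i(U(b',c), ⨂Sym(𝒪²))`. [cite: Hida1994AIF, §2] -/
theorem relIndex_smul_eq_zero_of_latticeRes_eq_zero (h𝒰 : 𝒰.IsMaximalAbove) {b b' c : ℕ} (hb : b' ≤ b)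
    (hbc : b ≤ c) (h1 : 1 ≤ max b' c) (i : ℕ)
    {x : LevelAction.cohomology (globalEmbedding 2 F) (integralMonoid F (padicPlace F p))
        (symLatticeAction (padicEmbInt F p) (PadicAlgCl p) F k (padicPlace F p) (padicEmbIntHom F p)) (𝒰.level b' c) i}
    (hx : (latticeRes F k p 𝒰 hb c i).hom x = 0) :
    (𝒰.level b c).relIndex (𝒰.level b' c) • x = 0 := by
  rw [← latticeTr_latticeRes_apply F k p h𝒰 hb hbc h1 i x, hx, map_zero]

/-- **The cokernel of `res : H(b') → H(b)^{T(b')}` is killed by the index**: for a class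
`y ∈ H^i(U(b,c), ⨂Sym(𝒪²))` fixed by the diamonds `⟨u⟩`, `u ∈ T(b')`, one has
`[U(b',c) : U(b,c)] · y = res (tr y) ∈ range res`. [cite: Hida1994AIF, §2] [cite: KhareThorne2017, §6.3] -/
theorem relIndex_smul_mem_range_latticeRes (h𝒰 : 𝒰.IsMaximalAbove) {b b' c : ℕ} (hb : b' ≤ b)
    (hbc : b ≤ c) (h1 : 1 ≤ max b' c) (i : ℕ)
    {y : LevelAction.cohomology (globalEmbedding 2 F) (integralMonoid F (padicPlace F p))
        (symLatticeAction (padicEmbInt F p) (PadicAlgCl p) F k (padicPlace F p) (padicEmbIntHom F p)) (𝒰.level b c) i}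
    (hy : ∀ u : ∀ w : PlacesAbove F p, (Fin 2 → (w.1.adicCompletionIntegers F)ˣ),
      (∀ w, u w ∈ torusBall w.1 b') → latticeDiamond F k p h𝒰 b c i u y = y) :
    (𝒰.level b c).relIndex (𝒰.level b' c) • y ∈ LinearMap.range (latticeRes F k p 𝒰 hb c i).hom := by
  obtain ⟨S, hSb, hS⟩ := 𝒰.exists_diamond_transversal h𝒰 hbc h1
  refine ⟨(latticeTr F k p 𝒰 b b' c i).hom y, ?_⟩
  rw [latticeRes_latticeTr_apply F k p h𝒰 hb hbc hS i y,
    Finset.sum_congr rfl fun u hu => hy u (hSb u hu), Finset.sum_const,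
    card_eq_relIndex_family (diamondPi 2 F p) hS]

/-- The same for the whole `T(1)`: a class fixed by ALL diamonds has `[U(b',c):U(b,c)] · y ∈ range res`
for every `b' ≤ b`. [cite: Hida1994AIF, §2] -/
theorem relIndex_smul_mem_range_latticeRes_of_forall (h𝒰 : 𝒰.IsMaximalAbove) {b b' c : ℕ} (hb : b' ≤ b)
    (hbc : b ≤ c) (h1 : 1 ≤ max b' c) (i : ℕ)
    {y : LevelAction.cohomology (globalEmbedding 2 F) (integralMonoid F (padicPlace F p))
        (symLatticeAction (padicEmbInt F p) (PadicAlgCl p) F k (padicPlace F p) (padicEmbIntHom F p)) (𝒰.level b c) i}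
    (hy : ∀ u, latticeDiamond F k p h𝒰 b c i u y = y) :
    (𝒰.level b c).relIndex (𝒰.level b' c) • y ∈ LinearMap.range (latticeRes F k p 𝒰 hb c i).hom :=
  relIndex_smul_mem_range_latticeRes F k p h𝒰 hb hbc h1 i fun u _ => hy u

end Literature.NumberTheory.Automorphic.ParallelWeight
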